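import Mathlib
import Summits.NavierStokesRegularity.NavierStokesRegularity.Theorems.L3TimeExponentPincerEffNode
import HarnessLib.Audit
import HarnessLib

/-!
# The `L³`-pace dichotomy of the crux `EffSatBlowup` (route `L3TimeExponentPincer`, item
# `stmt-NavierStokesRegularity-19139`)

Support file (cell ns-regularity-ideate, seat p2, ROUND-8).  `EffSatBlowup` (= `K₃(1)` on the blow-up branch of the
route's Leray–Hopf frame) asks, at every late time `t` of a blow-up at `T`, for an `L³`-effective speed `U`
(`‖u(t)‖₃³ ≤ L·U`) whose CAUSAL ball (radius `r ≥ R₀ U (T-t)`) is FAT (`m U² r³ ≤ ∫_{B_r}|u(t)|²`).  This file splits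
the crux along the `L³` PACE of the blow-up and proves everything except two named open pieces:

* §1  definitions: the clause `FatClauseAt`, `EffSatNear` (= the matrix of `EffSatBlowup`: `effSatBlowup_iff` is
  `Iff.rfl`), `ParabolicConcentration` (the shape of the UNCONDITIONAL parabolic `L²` concentration of
  Kang–Miura–Tsai 2020 Thm 1.6(i) / Bradshaw–Tsai 2020), `L3Slow` (`‖u(t)‖₃³ ≤ A (T-t)^{-1/2}`, the `L³`-Type-I
  pace), `FastTimesFat` (the clause demanded only at `L³`-FAST times), `MorreyTypeINear` (Barker–Prange 2020 (1.7),
  energy spelling).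
* §2  **slow slice (theorem `effSatNear_of_parabolic_of_slow`):** parabolic concentration + `L³`-slow ⇒ the clause
  at every late time: `U = A/√(T-t)`, `r = c√(T-t) = R₀ U (T-t)` with `R₀ = c/A`, `m = γ/(A²c³)`.  So `K₃(1)` HOLDS
  for every blow-up of `L³`-pace `≤ 1/6` that concentrates parabolically — strictly wider than the sup-Type-I slice
  `L3TimeExponentPincerTypeIRung` (sup-Type-I ⇒ `‖u‖₃³ ≤ ‖u‖_∞‖u‖₂² = O((T-t)^{-1/2})`).
* §3  **dichotomy (theorem `effSatNear_of_parabolic_of_fastFat`):** parabolic concentration + fatness at fast times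
  ⇒ the clause; frame level `ParabolicConcentrationB → FastTimesFatB → EffSatBlowup` and
  `EffSatBlowup ↔ FastTimesFatB` given `ParabolicConcentrationB`: modulo the print fact, the crux IS its restriction
  to `L³`-fast times (`‖u(t)‖₃³ √(T-t)` unbounded).
* §4  **Morrey side (theorem `l3Slow_of_effSatNear_of_morreyTypeI`):** at a fast time the clause forces a ball of
  SUPER-critical Morrey ratio (`energy/r ≥ m R₀² (U²(T-t))² → ∞`), so under a Morrey-Type-I bound the clause forces
  `L³`-slowness.  Frame level: `EffSatBlowup → MorreyTypeISlowB` ("Morrey-Type-I blow-ups have `L³`-Type-I pace"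
  — a NECESSARY consequence of the crux, hence a falsifier target) and, given `ParabolicConcentrationB`,
  `EffSatBlowupMTI ↔ MorreyTypeISlowB`: on the Morrey-Type-I class the crux is EQUIVALENT to a pure RATE statement.

0 `sorry`.  Open pieces are `@[conjecture]` defs used only as hypotheses: `ParabolicConcentrationB` (in print:
KMT20 Thm 1.6(i) — to be discharged by a Literature transcription + maximal-time bridge), `FastTimesFatB` (open:
the crux at fast times), `MorreyTypeISlowB` (new typed question), `EffSatBlowupMTI` (the crux on the MTI class).
References: K. Kang, H. Miura, T.-P. Tsai, arXiv:2006.13145, Thm 1.6 / Rmk 1.7; Z. Bradshaw, T.-P. Tsai,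
arXiv:2001.11526; T. Barker, C. Prange, arXiv:1812.09115 (ARMA 236 (2020)), (1.7) and Thm 2 [BarkerPrange2020].
-/

noncomputable section

namespace Summit.NavierStokesRegularity.NavierStokesRegularity.Theorems.L3TimeExponentPincerPaceDichotomy

open MeasureTheory Set Filter Metric Function Topology
open scoped ENNReal NNReal Topology
open Literature.Analysis.FluidPDE
open Summit.NavierStokesRegularity.NavierStokesRegularity.Theorems.L3TimeExponentPincerEffNode

/-! ## §1  Definitions -/

/-- The `K₃(1)` clause of `EffSatBlowup` at ONE time `t`, constants `(m, R₀, L)`: some `U ≥ 0` with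
`‖u(t)‖₃³ ≤ L U` carries a ball of radius `r ≥ R₀ U (T-t)` with `m U² r³ ≤ ∫_{B(x₀,r)} |u(t)|²`. -/
def FatClauseAt (m R₀ L : ℝ) (u : ℝ → EuclideanSpace ℝ (Fin 3) → EuclideanSpace ℝ (Fin 3)) (T t : ℝ) : Prop :=
  ∃ U : ℝ, 0 ≤ U ∧ eLpNorm (u t) 3 volume ^ (3 : ℝ) ≤ ENNReal.ofReal (L * U) ∧
    ∃ x₀ : EuclideanSpace ℝ (Fin 3), ∃ r : ℝ, R₀ * U * (T - t) ≤ r ∧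
      ENNReal.ofReal (m * (U ^ 2 * r ^ 3)) ≤ ∫⁻ x in ball x₀ r, ‖u t x‖ₑ ^ 2

/-- `K₃(1)` near `T` for one field, in the exact spelling of `EffSatBlowup`. -/
def EffSatNear (u : ℝ → EuclideanSpace ℝ (Fin 3) → EuclideanSpace ℝ (Fin 3)) (T : ℝ) : Prop :=
  ∃ m : ℝ, 0 < m ∧ ∃ R₀ : ℝ, 0 < R₀ ∧ ∃ L : ℝ, 0 < L ∧ ∃ T₁ < T, ∀ t ∈ Ioo T₁ T, FatClauseAt m R₀ L u T t

/-- `EffSatBlowup` is literally "`EffSatNear u T` for every blow-up of the frame". -/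
theorem effSatBlowup_iff :
    EffSatBlowup ↔ ∀ (ν T : ℝ), 0 < ν → 0 < T →
      ∀ (u : ℝ → EuclideanSpace ℝ (Fin 3) → EuclideanSpace ℝ (Fin 3)) (p : ℝ → EuclideanSpace ℝ (Fin 3) → ℝ),
        IsClassicalNSSolutionOn (Ico 0 T) ν 0 u p → IsLerayHopfOn T ν 0 (u 0) u →
        HasRapidSpatialDecay (u 0) → ¬ HasSmoothExtensionPast ν 0 u T → EffSatNear u T :=
  Iff.rfl

/-- **Parabolic `L²` concentration near `T`** (the shape of Kang–Miura–Tsai 2020 Thm 1.6(i) = Bradshaw–Tsai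
2020: `(T-t)^{-1/2} ∫_{B(x(t), √((T-t)/S₀))} |u(t)|² > ε` at every `t < T`, `T` the maximal `L^∞` time; here
with free constants `γ, c` and a final window). -/
def ParabolicConcentration (u : ℝ → EuclideanSpace ℝ (Fin 3) → EuclideanSpace ℝ (Fin 3)) (T : ℝ) : Prop :=
  ∃ γ : ℝ, 0 < γ ∧ ∃ c : ℝ, 0 < c ∧ ∃ T₁ < T, ∀ t ∈ Ioo T₁ T,
    ∃ x₀ : EuclideanSpace ℝ (Fin 3),
      ENNReal.ofReal (γ * Real.sqrt (T - t)) ≤ ∫⁻ x in ball x₀ (c * Real.sqrt (T - t)), ‖u t x‖ₑ ^ 2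

/-- **`L³`-slow** (`L³`-Type-I pace, exponent `1/6` for `‖u(t)‖₃`): `‖u(t)‖₃³ ≤ A/√(T-t)` on a final window. -/
def L3Slow (u : ℝ → EuclideanSpace ℝ (Fin 3) → EuclideanSpace ℝ (Fin 3)) (T : ℝ) : Prop :=
  ∃ A : ℝ, 0 < A ∧ ∃ T₁ < T, ∀ t ∈ Ioo T₁ T,
    eLpNorm (u t) 3 volume ^ (3 : ℝ) ≤ ENNReal.ofReal (A / Real.sqrt (T - t))

/-- **Fatness at `L³`-fast times**: the `K₃(1)` clause demanded only at times with `‖u(t)‖₃³ > A/√(T-t)`,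
the threshold `A` chosen by the statement. -/
def FastTimesFat (u : ℝ → EuclideanSpace ℝ (Fin 3) → EuclideanSpace ℝ (Fin 3)) (T : ℝ) : Prop :=
  ∃ A : ℝ, 0 < A ∧ ∃ m : ℝ, 0 < m ∧ ∃ R₀ : ℝ, 0 < R₀ ∧ ∃ L : ℝ, 0 < L ∧ ∃ T₁ < T, ∀ t ∈ Ioo T₁ T,
    ENNReal.ofReal (A / Real.sqrt (T - t)) < eLpNorm (u t) 3 volume ^ (3 : ℝ) → FatClauseAt m R₀ L u T t

/-- **Morrey-Type-I bound near `T`** (Barker–Prange 2020 (1.7), energy spelling, viscosity absorbed in `M`):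
`∫_{B(x₀,r)} |u(t)|² ≤ M r` for all centres, all radii `0 < r < r₁` and all times `T - r² < t < T`. -/
def MorreyTypeINear (u : ℝ → EuclideanSpace ℝ (Fin 3) → EuclideanSpace ℝ (Fin 3)) (T : ℝ) : Prop :=
  ∃ M : ℝ, 0 < M ∧ ∃ r₁ : ℝ, 0 < r₁ ∧ ∀ x₀ : EuclideanSpace ℝ (Fin 3), ∀ r : ℝ, 0 < r → r < r₁ →
    ∀ t : ℝ, T - r ^ 2 < t → t < T → ∫⁻ x in ball x₀ r, ‖u t x‖ₑ ^ 2 ≤ ENNReal.ofReal (M * r)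

/-- Monotonicity of the clause in its constants (smaller `m`, `R₀`, larger `L`). -/
theorem fatClauseAt_mono {m m' R₀ R₀' L L' : ℝ}
    {u : ℝ → EuclideanSpace ℝ (Fin 3) → EuclideanSpace ℝ (Fin 3)} {T t : ℝ}
    (hm' : 0 ≤ m') (hmm : m' ≤ m) (hRR : R₀' ≤ R₀) (hLL : L ≤ L') (ht : t ≤ T)
    (h : FatClauseAt m R₀ L u T t) : FatClauseAt m' R₀' L' u T t := by
  obtain ⟨U, hU, h3, x₀, r, hr, hfat⟩ := h
  have hUs : 0 ≤ U * (T - t) := mul_nonneg hU (sub_nonneg.2 ht)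
  refine ⟨U, hU, h3.trans (ENNReal.ofReal_le_ofReal (mul_le_mul_of_nonneg_right hLL hU)), x₀, r, ?_, ?_⟩
  · calc R₀' * U * (T - t) = R₀' * (U * (T - t)) := by ring
      _ ≤ R₀ * (U * (T - t)) := mul_le_mul_of_nonneg_right hRR hUs
      _ = R₀ * U * (T - t) := by ring
      _ ≤ r := hr
  · rcases le_or_gt 0 (U ^ 2 * r ^ 3) with h0 | h0
    · exact le_trans (ENNReal.ofReal_le_ofReal (mul_le_mul_of_nonneg_right hmm h0)) hfat
    · rw [ENNReal.ofReal_of_nonpos (mul_nonpos_iff.2 (Or.inl ⟨hm', h0.le⟩))]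
      exact bot_le


/-! ## §2  The slow slice: parabolic concentration + `L³`-Type-I pace ⇒ the clause -/

/-- One time: a parabolic ball `B(x₀, c√s)` with energy `≥ γ√s` and `‖u(t)‖₃³ ≤ A/√s` (`s = T - t`) give the
clause with `U = A/√s`, `R₀ = c/A`, `L = 1`, `m = γ/(A²c³)`. -/
theorem fatClauseAt_of_parabolic_of_slow {γ c A : ℝ}
    {u : ℝ → EuclideanSpace ℝ (Fin 3) → EuclideanSpace ℝ (Fin 3)} {T t : ℝ}
    (hγ : 0 < γ) (hc : 0 < c) (hA : 0 < A) (ht : t < T)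
    (hPC : ∃ x₀ : EuclideanSpace ℝ (Fin 3),
      ENNReal.ofReal (γ * Real.sqrt (T - t)) ≤ ∫⁻ x in ball x₀ (c * Real.sqrt (T - t)), ‖u t x‖ₑ ^ 2)
    (hslow : eLpNorm (u t) 3 volume ^ (3 : ℝ) ≤ ENNReal.ofReal (A / Real.sqrt (T - t))) :
    FatClauseAt (γ / (A ^ 2 * c ^ 3)) (c / A) 1 u T t := by
  obtain ⟨x₀, hx₀⟩ := hPC
  set s : ℝ := T - t with hsdef
  have hs : 0 < s := sub_pos.2 ht
  set q : ℝ := Real.sqrt s with hqdef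
  have hq : 0 < q := Real.sqrt_pos.2 hs
  have hqq : q ^ 2 = s := Real.sq_sqrt hs.le
  have hA0 : A ≠ 0 := hA.ne'
  have hq0 : q ≠ 0 := hq.ne'
  have hc0 : c ≠ 0 := hc.ne'
  refine ⟨A / q, by positivity, by simpa only [one_mul] using hslow, x₀, c * q, ?_, ?_⟩
  · have h1 : c / A * (A / q) * s = c * q := by
      rw [← hqq]; field_simp
    exact h1.le
  · have h2 : γ / (A ^ 2 * c ^ 3) * ((A / q) ^ 2 * (c * q) ^ 3) = γ * q := by
      field_simp
    rw [h2]
    exact hx₀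

/-- **The slow slice.**  Parabolic concentration + `L³`-slow ⇒ `K₃(1)` near `T`. -/
theorem effSatNear_of_parabolic_of_slow
    {u : ℝ → EuclideanSpace ℝ (Fin 3) → EuclideanSpace ℝ (Fin 3)} {T : ℝ}
    (hP : ParabolicConcentration u T) (hS : L3Slow u T) : EffSatNear u T := by
  obtain ⟨γ, hγ, c, hc, T₁, hT₁, hPC⟩ := hP
  obtain ⟨A, hA, T₁', hT₁', hslow⟩ := hS
  refine ⟨γ / (A ^ 2 * c ^ 3), by positivity, c / A, by positivity, 1, one_pos, max T₁ T₁',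
    max_lt hT₁ hT₁', fun t ht => ?_⟩
  have ht1 : t ∈ Ioo T₁ T := ⟨lt_of_le_of_lt (le_max_left _ _) ht.1, ht.2⟩
  have ht2 : t ∈ Ioo T₁' T := ⟨lt_of_le_of_lt (le_max_right _ _) ht.1, ht.2⟩
  exact fatClauseAt_of_parabolic_of_slow hγ hc hA ht.2 (hPC t ht1) (hslow t ht2)

/-- The slow slice in the tree's `K₃(σ)` currency at `σ = 1`. -/
theorem effSaturatesAt_one_of_effSatNear
    {u : ℝ → EuclideanSpace ℝ (Fin 3) → EuclideanSpace ℝ (Fin 3)} {T : ℝ}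
    (h : EffSatNear u T) : EffSaturatesAt 1 u T := by
  obtain ⟨m, hm, R₀, hR₀, L, hL, T₁, hT₁, hcl⟩ := h
  refine ⟨m, hm, R₀, hR₀, L, hL, T₁, hT₁, fun t ht => ?_⟩
  obtain ⟨U, hU, h3, x₀, r, hr, hfat⟩ := hcl t ht
  refine ⟨U, hU, h3, x₀, r, ?_, hfat⟩
  have h1 : U ^ (2 * (1 : ℝ) - 1) = U := by norm_num
  have h2 : (T - t) ^ (1 : ℝ) = T - t := Real.rpow_one _
  rw [h1, h2]
  exact hr


/-! ## §3  The dichotomy: parabolic concentration + fatness at fast times ⇒ the clause -/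

/-- **The pace dichotomy.**  Parabolic concentration handles the `L³`-slow times, `FastTimesFat` the fast ones. -/
theorem effSatNear_of_parabolic_of_fastFat
    {u : ℝ → EuclideanSpace ℝ (Fin 3) → EuclideanSpace ℝ (Fin 3)} {T : ℝ}
    (hP : ParabolicConcentration u T) (hF : FastTimesFat u T) : EffSatNear u T := by
  obtain ⟨γ, hγ, c, hc, T₁, hT₁, hPC⟩ := hP
  obtain ⟨A, hA, m, hm, R₀, hR₀, L, hL, T₁', hT₁', hfast⟩ := hF
  refine ⟨min m (γ / (A ^ 2 * c ^ 3)), lt_min hm (by positivity), min R₀ (c / A), lt_min hR₀ (by positivity),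
    max L 1, lt_of_lt_of_le hL (le_max_left _ _), max T₁ T₁', max_lt hT₁ hT₁', fun t ht => ?_⟩
  have ht1 : t ∈ Ioo T₁ T := ⟨lt_of_le_of_lt (le_max_left _ _) ht.1, ht.2⟩
  have ht2 : t ∈ Ioo T₁' T := ⟨lt_of_le_of_lt (le_max_right _ _) ht.1, ht.2⟩
  have hmin0 : 0 ≤ min m (γ / (A ^ 2 * c ^ 3)) := (lt_min hm (by positivity)).le
  rcases le_or_gt (eLpNorm (u t) 3 volume ^ (3 : ℝ)) (ENNReal.ofReal (A / Real.sqrt (T - t))) with hsl | hfa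
  · exact fatClauseAt_mono hmin0 (min_le_right _ _) (min_le_right _ _) (le_max_right _ _) ht.2.le
      (fatClauseAt_of_parabolic_of_slow hγ hc hA ht.2 (hPC t ht1) hsl)
  · exact fatClauseAt_mono hmin0 (min_le_left _ _) (min_le_left _ _) (le_max_left _ _) ht.2.le
      (hfast t ht2 hfa)

/-- Conversely the clause at all late times trivially gives it at the fast ones. -/
theorem fastTimesFat_of_effSatNear
    {u : ℝ → EuclideanSpace ℝ (Fin 3) → EuclideanSpace ℝ (Fin 3)} {T : ℝ}
    (h : EffSatNear u T) : FastTimesFat u T := by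
  obtain ⟨m, hm, R₀, hR₀, L, hL, T₁, hT₁, hcl⟩ := h
  exact ⟨1, one_pos, m, hm, R₀, hR₀, L, hL, T₁, hT₁, fun t ht _ => hcl t ht⟩

/-- **Parabolic concentration on the blow-up branch of the frame** — IN PRINT (Kang–Miura–Tsai 2020 Thm 1.6(i),
unconditional for local energy solutions at the maximal `L^∞` time; Bradshaw–Tsai 2020): every frame solution
that does not extend smoothly past `T` concentrates energy `≥ γ√(T-t)` in some ball of radius `c√(T-t)` at every
late time.  Tagged `conjecture` only because the Literature transcription (+ the identification of `T` with the
maximal time) is not yet in the tree. -/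
@[conjecture] def ParabolicConcentrationB : Prop :=
  ∀ (ν T : ℝ), 0 < ν → 0 < T →
    ∀ (u : ℝ → EuclideanSpace ℝ (Fin 3) → EuclideanSpace ℝ (Fin 3)) (p : ℝ → EuclideanSpace ℝ (Fin 3) → ℝ),
      IsClassicalNSSolutionOn (Ico 0 T) ν 0 u p → IsLerayHopfOn T ν 0 (u 0) u →
      HasRapidSpatialDecay (u 0) → ¬ HasSmoothExtensionPast ν 0 u T → ParabolicConcentration u T

/-- **Fatness at `L³`-fast times on the blow-up branch** — the OPEN residue of the crux after §2. -/
@[conjecture] def FastTimesFatB : Prop :=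
  ∀ (ν T : ℝ), 0 < ν → 0 < T →
    ∀ (u : ℝ → EuclideanSpace ℝ (Fin 3) → EuclideanSpace ℝ (Fin 3)) (p : ℝ → EuclideanSpace ℝ (Fin 3) → ℝ),
      IsClassicalNSSolutionOn (Ico 0 T) ν 0 u p → IsLerayHopfOn T ν 0 (u 0) u →
      HasRapidSpatialDecay (u 0) → ¬ HasSmoothExtensionPast ν 0 u T → FastTimesFat u T

/-- **Frame-level dichotomy**: the print fact + fatness at fast times ⇒ the crux `EffSatBlowup`. -/
theorem effSatBlowup_of_parabolicB_of_fastFatB (h₁ : ParabolicConcentrationB) (h₂ : FastTimesFatB) :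
    EffSatBlowup := by
  intro ν T hν hT u p hcl hLH hdec hns
  exact effSatNear_of_parabolic_of_fastFat (h₁ ν T hν hT u p hcl hLH hdec hns) (h₂ ν T hν hT u p hcl hLH hdec hns)

/-- … and conversely; so, modulo the print fact, **the crux is its fast-times restriction**. -/
theorem fastTimesFatB_of_effSatBlowup (h : EffSatBlowup) : FastTimesFatB := by
  intro ν T hν hT u p hcl hLH hdec hns
  exact fastTimesFat_of_effSatNear (h ν T hν hT u p hcl hLH hdec hns)

/-- Modulo the print fact `ParabolicConcentrationB`, the crux `EffSatBlowup` is its fast-times restriction. -/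
theorem effSatBlowup_iff_fastTimesFatB (h₁ : ParabolicConcentrationB) : EffSatBlowup ↔ FastTimesFatB :=
  ⟨fastTimesFatB_of_effSatBlowup, effSatBlowup_of_parabolicB_of_fastFatB h₁⟩


/-! ## §4  The Morrey side: at fast times the clause is super-critical Morrey concentration -/

/-- **Under a Morrey-Type-I bound the clause forces `L³`-Type-I pace.**  If every ball of radius `r < r₁` carries
energy `≤ M r` at times `T - r² < t < T`, the total energy is `≤ E` near `T`, and `K₃(1)` holds near `T`, then
`‖u(t)‖₃³ ≤ A/√(T-t)` near `T`.  (At a time with `U > A₀/√s` the fat causal ball has `√s < r < r₁` and Morrey ratio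
`m U² r² ≥ m R₀² U⁴ s²`, which the bound caps: `U² s ≤ √(M/(m R₀²))`.) -/
theorem l3Slow_of_effSatNear_of_morreyTypeI
    {u : ℝ → EuclideanSpace ℝ (Fin 3) → EuclideanSpace ℝ (Fin 3)} {T T₀ E : ℝ} (hE : 0 ≤ E) (hT₀ : T₀ < T)
    (henergy : ∀ t ∈ Ioo T₀ T, ∫⁻ x, ‖u t x‖ₑ ^ 2 ≤ ENNReal.ofReal E)
    (hK : EffSatNear u T) (hMor : MorreyTypeINear u T) : L3Slow u T := by
  obtain ⟨m, hm, R₀, hR₀, L, hL, T₁, hT₁, hcl⟩ := hK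
  obtain ⟨M, hM, r₁, hr₁, hMr⟩ := hMor
  -- thresholds
  set A₀ : ℝ := max (1 / R₀) 1 with hA₀def
  have hA₀pos : 0 < A₀ := lt_of_lt_of_le one_pos (le_max_right _ _)
  have hA₀R : 1 ≤ R₀ * A₀ := by
    rw [mul_comm]; exact (div_le_iff₀ hR₀).1 (le_max_left _ _)
  set B : ℝ := max 1 (M / (m * R₀ ^ 2)) with hBdef
  have hB1 : 1 ≤ B := le_max_left _ _
  have hBpos : 0 < B := lt_of_lt_of_le one_pos hB1
  set δ : ℝ := A₀ ^ 2 * m * r₁ ^ 3 / (E + 1) with hδdef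
  have hδ : 0 < δ := by positivity
  refine ⟨L * max A₀ B, by positivity, max (max T₀ T₁) (T - δ), max_lt (max_lt hT₀ hT₁) (by linarith),
    fun t ht => ?_⟩
  have ht₀ : T₀ < t := lt_of_le_of_lt ((le_max_left _ _).trans (le_max_left _ _)) ht.1
  have ht₁ : T₁ < t := lt_of_le_of_lt ((le_max_right _ _).trans (le_max_left _ _)) ht.1
  have htδ : T - δ < t := lt_of_le_of_lt (le_max_right _ _) ht.1
  have htT : t < T := ht.2
  set s : ℝ := T - t with hsdef
  have hs : 0 < s := sub_pos.2 htT
  have hsδ : s < δ := by rw [hsdef]; linarith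
  set q : ℝ := Real.sqrt s with hqdef
  have hq : 0 < q := Real.sqrt_pos.2 hs
  have hqq : q ^ 2 = s := Real.sq_sqrt hs.le
  have hq0 : q ≠ 0 := hq.ne'
  obtain ⟨U, hU, h3, x₀, r, hr, hfat⟩ := hcl t ⟨ht₁, htT⟩
  -- it suffices to bound `U` by `max A₀ B / √s`
  suffices hUq : U ≤ max A₀ B / q by
    refine h3.trans (ENNReal.ofReal_le_ofReal ?_)
    calc L * U ≤ L * (max A₀ B / q) := mul_le_mul_of_nonneg_left hUq hL.le
      _ = L * max A₀ B / q := by ring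
  rcases le_or_gt U (A₀ / q) with hle | hgt
  · calc U ≤ A₀ / q := hle
      _ ≤ max A₀ B / q := by gcongr; exact le_max_left _ _
  -- FAST case: `U > A₀/√s`
  have hAq : 0 < A₀ / q := by positivity
  have hUpos : 0 < U := hAq.trans hgt
  -- (a) the causal ball is super-parabolic: `r > √s`
  have hqr : q < r := by
    calc q ≤ R₀ * A₀ * q := le_mul_of_one_le_left hq.le hA₀R
      _ = R₀ * (A₀ / q) * s := by rw [← hqq]; field_simp
      _ < R₀ * U * s := by
          have h1 : R₀ * (A₀ / q) < R₀ * U := mul_lt_mul_of_pos_left hgt hR₀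
          exact mul_lt_mul_of_pos_right h1 hs
      _ ≤ r := hr
  have hrpos : 0 < r := hq.trans hqr
  have hr2 : T - r ^ 2 < t := by
    have h1 : q ^ 2 < r ^ 2 := by gcongr
    rw [hqq] at h1
    linarith
  -- (b) energy: `m U² r³ ≤ E`
  have hE' : m * (U ^ 2 * r ^ 3) ≤ E := by
    have h1 : ∫⁻ x in ball x₀ r, ‖u t x‖ₑ ^ 2 ≤ ENNReal.ofReal E :=
      (setLIntegral_le_lintegral _ _).trans (henergy t ⟨ht₀, htT⟩)
    exact (ENNReal.ofReal_le_ofReal_iff hE).1 (hfat.trans h1)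
  -- (c) the window is short enough that `r < r₁`
  have hrr₁ : r < r₁ := by
    by_contra hc
    rw [not_lt] at hc
    have h1 : m * (U ^ 2 * r₁ ^ 3) ≤ E := by
      refine le_trans ?_ hE'
      gcongr
    have h2 : (A₀ / q) ^ 2 < U ^ 2 := by gcongr
    rw [div_pow, hqq] at h2
    have h4 : s * (E + 1) < A₀ ^ 2 * m * r₁ ^ 3 := (lt_div_iff₀ (by positivity)).1 hsδ
    have h5 : E + 1 < m * r₁ ^ 3 * (A₀ ^ 2 / s) := by
      rw [show m * r₁ ^ 3 * (A₀ ^ 2 / s) = (A₀ ^ 2 * m * r₁ ^ 3) / s by ring, lt_div_iff₀ hs]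
      linarith
    have h6 : m * r₁ ^ 3 * (A₀ ^ 2 / s) < m * r₁ ^ 3 * U ^ 2 := mul_lt_mul_of_pos_left h2 (by positivity)
    have h7 : m * r₁ ^ 3 * U ^ 2 = m * (U ^ 2 * r₁ ^ 3) := by ring
    linarith
  -- (d) the Morrey bound on the fat ball caps `U² s`
  have hMball : ∫⁻ x in ball x₀ r, ‖u t x‖ₑ ^ 2 ≤ ENNReal.ofReal (M * r) := hMr x₀ r hrpos hrr₁ t hr2 htT
  have hreal : m * (U ^ 2 * r ^ 3) ≤ M * r :=
    (ENNReal.ofReal_le_ofReal_iff (by positivity)).1 (hfat.trans hMball)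
  have h8 : m * (U ^ 2 * r ^ 2) ≤ M := by
    have h1 : m * (U ^ 2 * r ^ 2) * r ≤ M * r := by
      calc m * (U ^ 2 * r ^ 2) * r = m * (U ^ 2 * r ^ 3) := by ring
        _ ≤ M * r := hreal
    exact le_of_mul_le_mul_right h1 hrpos
  have h9 : (R₀ * U * s) ^ 2 ≤ r ^ 2 := by
    have h0 : 0 ≤ R₀ * U * s := by positivity
    gcongr
  have h10 : R₀ ^ 2 * (U ^ 2 * s) ^ 2 ≤ M / m := by
    rw [le_div_iff₀ hm]
    calc R₀ ^ 2 * (U ^ 2 * s) ^ 2 * m = m * (U ^ 2 * (R₀ * U * s) ^ 2) := by ring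
      _ ≤ m * (U ^ 2 * r ^ 2) := by gcongr
      _ ≤ M := h8
  have h11a : (U ^ 2 * s) ^ 2 ≤ M / (m * R₀ ^ 2) := by
    rw [← div_div]
    exact (le_div_iff₀' (by positivity)).2 h10
  have hBB : B ≤ B ^ 2 := by nlinarith [hB1]
  have h11 : (U ^ 2 * s) ^ 2 ≤ B ^ 2 :=
    h11a.trans ((le_max_right _ _).trans hBB)
  have h12 : U ^ 2 * s ≤ B := le_of_pow_le_pow_left₀ two_ne_zero hBpos.le h11
  have h13 : (U * q) ^ 2 ≤ B ^ 2 := by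
    calc (U * q) ^ 2 = U ^ 2 * s := by rw [mul_pow, hqq]
      _ ≤ B := h12
      _ ≤ B ^ 2 := hBB
  have h14 : U * q ≤ B := le_of_pow_le_pow_left₀ two_ne_zero hBpos.le h13
  have h15 : U ≤ B / q := by rw [le_div_iff₀ hq]; exact h14
  calc U ≤ B / q := h15
    _ ≤ max A₀ B / q := by gcongr; exact le_max_right _ _

/-- **"Morrey-Type-I blow-ups have `L³`-Type-I pace"** — the typed rate question of ROUND-8: every frame blow-up
obeying a Morrey-Type-I bound near `T` has `‖u(t)‖₃³ = O((T-t)^{-1/2})`.  Trivial under the POINTWISE Type-I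
rate (`‖u‖₃³ ≤ ‖u‖_∞ ‖u‖₂²`); open, as far as we know, under the Morrey bound (1.7) of Barker–Prange. -/
@[conjecture] def MorreyTypeISlowB : Prop :=
  ∀ (ν T : ℝ), 0 < ν → 0 < T →
    ∀ (u : ℝ → EuclideanSpace ℝ (Fin 3) → EuclideanSpace ℝ (Fin 3)) (p : ℝ → EuclideanSpace ℝ (Fin 3) → ℝ),
      IsClassicalNSSolutionOn (Ico 0 T) ν 0 u p → IsLerayHopfOn T ν 0 (u 0) u →
      HasRapidSpatialDecay (u 0) → ¬ HasSmoothExtensionPast ν 0 u T → MorreyTypeINear u T → L3Slow u T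

/-- The crux restricted to the Morrey-Type-I class. -/
@[conjecture] def EffSatBlowupMTI : Prop :=
  ∀ (ν T : ℝ), 0 < ν → 0 < T →
    ∀ (u : ℝ → EuclideanSpace ℝ (Fin 3) → EuclideanSpace ℝ (Fin 3)) (p : ℝ → EuclideanSpace ℝ (Fin 3) → ℝ),
      IsClassicalNSSolutionOn (Ico 0 T) ν 0 u p → IsLerayHopfOn T ν 0 (u 0) u →
      HasRapidSpatialDecay (u 0) → ¬ HasSmoothExtensionPast ν 0 u T → MorreyTypeINear u T → EffSatNear u T

/-- The crux trivially implies its restriction to the Morrey-Type-I class. -/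
theorem effSatBlowupMTI_of_effSatBlowup (h : EffSatBlowup) : EffSatBlowupMTI := by
  intro ν T hν hT u p hcl hLH hdec hns _
  exact h ν T hν hT u p hcl hLH hdec hns

/-- **The crux (already its MTI restriction) implies the rate statement** — via the Leray energy bound
`∫ |u(t)|² ≤ 2E(u₀)` (`IsLerayHopfOn.lintegral_enorm_sq_le`). -/
theorem morreyTypeISlowB_of_effSatBlowupMTI (h : EffSatBlowupMTI) : MorreyTypeISlowB := by
  intro ν T hν hT u p hcl hLH hdec hns hMor
  have hE : 0 ≤ 2 * VectorCalculus.kineticEnergy (u 0) :=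
    mul_nonneg zero_le_two (Literature.Analysis.FluidPDE.kineticEnergy_nonneg _)
  exact l3Slow_of_effSatNear_of_morreyTypeI hE hT
    (fun t ht => hLH.lintegral_enorm_sq_le hν.le ⟨ht.1.le, ht.2.le⟩)
    (h ν T hν hT u p hcl hLH hdec hns hMor) hMor

/-- **The crux implies the rate statement**: `EffSatBlowup → MorreyTypeISlowB` (a necessary consequence,
hence a falsifier target: a Morrey-Type-I blow-up with `‖u(t)‖₃³ √(T-t)` unbounded refutes the crux). -/
theorem morreyTypeISlowB_of_effSatBlowup (h : EffSatBlowup) : MorreyTypeISlowB :=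
  morreyTypeISlowB_of_effSatBlowupMTI (effSatBlowupMTI_of_effSatBlowup h)

/-- **… and conversely on the MTI class, given the print fact**: parabolic concentration + the rate statement ⇒
the crux for Morrey-Type-I blow-ups (the slow slice §2). -/
theorem effSatBlowupMTI_of_parabolicB_of_slowB (h₁ : ParabolicConcentrationB) (h₂ : MorreyTypeISlowB) :
    EffSatBlowupMTI := by
  intro ν T hν hT u p hcl hLH hdec hns hMor
  exact effSatNear_of_parabolic_of_slow (h₁ ν T hν hT u p hcl hLH hdec hns)
    (h₂ ν T hν hT u p hcl hLH hdec hns hMor)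

/-- **On the Morrey-Type-I class the crux is a RATE statement** (modulo KMT20 Thm 1.6(i)). -/
theorem effSatBlowupMTI_iff_morreyTypeISlowB (h₁ : ParabolicConcentrationB) :
    EffSatBlowupMTI ↔ MorreyTypeISlowB :=
  ⟨morreyTypeISlowB_of_effSatBlowupMTI, effSatBlowupMTI_of_parabolicB_of_slowB h₁⟩

end Summit.NavierStokesRegularity.NavierStokesRegularity.Theorems.L3TimeExponentPincerPaceDichotomy

end
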